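import Summits.AtomisticToContinuum.BoseEinsteinCondensation.Theorems.PeriodicIRBound.Negative.TwoModeStates

/-!
# Negative lemmas for crux `PeriodicIRBound` (stmt-AtomisticToContinuum-3972), XI: hard cores — all
energy is kinetic, an exact occupation sum rule

Supports (does not close) stmt-AtomisticToContinuum-3972, route `BECGroundStateSOS`. Landed copy of
§20 of `Cruxes/PeriodicIRBound/Disproof.lean` (cycle 2, gen-2 disprover seat); all `sorry`-free,
axioms `propext`/`Classical.choice`/`Quot.sound`.

* §20 `periodicEnergy_hardCore_eq_kinetic`, `hardCore_occupation_sumRule`, `hardCore_nearMin_sumRule`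
  — for the HARD CORE (`CorrectorClosure.Negative.hardCore`, admissible, non-integrable) the
  interaction density `V|Ψ|²` is `{0, ⊤}`-valued, so every finite-energy periodic state has
  `⟨Ψ,HΨ⟩ = ∫|∇Ψ|²` and, by the tree's Parseval identity
  `tsum_fracDispersion_two_mul_cellOccupation`, `∑_p |2πp/L|² n_p(Ψ) = ⟨Ψ,HΨ⟩` EXACTLY; a
  finite-energy `δ`-near-minimiser on `L_N` is pinned on the shell
  `E₀ ≤ ∑_p |2πp/L_N|² n_p ≤ E₀ + δ` (`E₀ ≈ 4πaρN`). The whole ground-state energy of the hard-core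
  gas is visible in its occupations — an f-sum-type identity the integrable half of the crux lacks
  (`T < E` there), offered to provers of the non-integrable half in place of the unavailable
  `‖v‖₁`/`v̂` double-commutator closures (file `HardCoreScope`).
-/

noncomputable section

open MeasureTheory Filter
open scoped ENNReal NNReal ComplexConjugate BigOperators
namespace Summit.AtomisticToContinuum.BoseEinsteinCondensation.Theorems.PeriodicIRBound.Negative

open Literature.MathematicalPhysics.QuantumManyBody.BoseGas
open Summit.AtomisticToContinuum.BoseEinsteinCondensation.Theses.BECGroundStateSOS
open Summit.AtomisticToContinuum.BoseEinsteinCondensation.Theorems.CorrectorClosure.Negative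
  (hardCore isRepulsiveFiniteRange_hardCore)

variable {L : ℝ} {N : ℕ}

/-! ## §20 HARD CORES: all energy is kinetic — an exact occupation sum rule for near-minimisers -/

/-- A measurable `{0, ⊤}`-valued function with finite lower integral integrates to `0`. [folklore] -/
theorem lintegral_eq_zero_of_zero_or_top {α : Type*} [MeasurableSpace α] {μ : Measure α}
    {g : α → ℝ≥0∞} (hg : Measurable g) (h01 : ∀ x, g x = 0 ∨ g x = ⊤)
    (hfin : ∫⁻ x, g x ∂μ ≠ ⊤) : ∫⁻ x, g x ∂μ = 0 := by
  by_cases hμ : μ {x | g x = ⊤} = 0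
  · have hae : g =ᵐ[μ] 0 := by
      filter_upwards [measure_eq_zero_iff_ae_notMem.1 hμ] with x hx
      exact (h01 x).resolve_right hx
    rw [lintegral_congr_ae hae]
    simp
  · exact absurd (lintegral_eq_top_of_measure_eq_top_ne_zero hg.aemeasurable hμ) hfin

/-- Finite sums of `{0, ⊤}`-valued terms are `{0, ⊤}`-valued. [folklore] -/
theorem sum_zero_or_top {ι : Type*} (s : Finset ι) (f : ι → ℝ≥0∞)
    (h : ∀ i ∈ s, f i = 0 ∨ f i = ⊤) : (∑ i ∈ s, f i) = 0 ∨ (∑ i ∈ s, f i) = ⊤ := by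
  refine Finset.sum_induction f (fun a => a = 0 ∨ a = ⊤) (fun a b ha hb => ?_) (Or.inl rfl) h
  rcases ha with rfl | rfl
  · simpa using hb
  · exact Or.inr (top_add b)

/-- The hard core takes only the values `0` and `⊤`. [folklore] -/
theorem hardCore_zero_or_top (r : ℝ) : hardCore r = 0 ∨ hardCore r = ⊤ := by
  unfold hardCore
  split_ifs <;> simp

/-- The periodised hard core takes only the values `0` and `⊤`. [folklore] -/
theorem periodizedPotential_hardCore_zero_or_top (L : ℝ) (x : Space) :
    periodizedPotential hardCore L x = 0 ∨ periodizedPotential hardCore L x = ⊤ := by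
  unfold periodizedPotential
  by_cases h : ∃ n : Fin 3 → ℤ, hardCore ‖x - latticeVec L n‖ = ⊤
  · exact Or.inr (ENNReal.tsum_eq_top_of_eq_top h)
  · push Not at h
    left
    have h0 : (fun n : Fin 3 → ℤ => hardCore ‖x - latticeVec L n‖) = fun _ => 0 :=
      funext fun n => ((hardCore_zero_or_top _).resolve_right (h n))
    rw [h0, tsum_zero]

/-- The periodic hard-core interaction takes only the values `0` and `⊤`. [folklore] -/
theorem periodicInteraction_hardCore_zero_or_top (L : ℝ) (X : Config N) :
    periodicInteraction hardCore L X = 0 ∨ periodicInteraction hardCore L X = ⊤ := by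
  unfold periodicInteraction
  exact sum_zero_or_top _ _ fun i _ => sum_zero_or_top _ _ fun j _ =>
    periodizedPotential_hardCore_zero_or_top L _

/-- The periodic interaction of a measurable potential is measurable (private re-proof to keep the
import cone small; canonical: `measurable_periodicInteraction` in `DiluteBoseGasUpperBoundLocalization`).
[folklore] -/
private theorem measurable_periodicInteraction_neg {v : ℝ → ℝ≥0∞} (hv : Measurable v) (L : ℝ) :
    Measurable (periodicInteraction (N := N) v L) := by
  unfold periodicInteraction periodizedPotential
  refine Finset.measurable_sum _ fun i _ => Finset.measurable_sum _ fun j _ => ?_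
  refine Measurable.tsum fun n => hv.comp ?_
  fun_prop

/-- **For the hard core all finite energy is kinetic**: `⟨Ψ, HΨ⟩ < ∞ ⇒ ⟨Ψ, HΨ⟩ = ∫_cell |∇Ψ|²`
(the interaction density `V|Ψ|²` is `{0, ⊤}`-valued, so a finite interaction integral vanishes: a
finite-energy state vanishes a.e. on the hard set and pays nothing elsewhere). [folklore] -/
theorem periodicEnergy_hardCore_eq_kinetic (Ψ : PeriodicTrialState N L)
    (hfin : periodicEnergy hardCore Ψ ≠ ⊤) :
    periodicEnergy hardCore Ψ = ∫⁻ X in cellN N L, kineticDensity Ψ.ψ X := by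
  unfold periodicEnergy at hfin ⊢
  rw [lintegral_add_left (measurable_kineticDensity_any _)] at hfin ⊢
  have hmeas : Measurable fun X : Config N =>
      periodicInteraction hardCore L X * (‖Ψ.ψ X‖₊ : ℝ≥0∞) ^ 2 :=
    (measurable_periodicInteraction_neg isRepulsiveFiniteRange_hardCore.1 L).mul
      ((Ψ.contDiff.continuous.measurable.nnnorm.coe_nnreal_ennreal).pow_const 2)
  have h01 : ∀ X : Config N, periodicInteraction hardCore L X * (‖Ψ.ψ X‖₊ : ℝ≥0∞) ^ 2 = 0 ∨
      periodicInteraction hardCore L X * (‖Ψ.ψ X‖₊ : ℝ≥0∞) ^ 2 = ⊤ := by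
    intro X
    rcases periodicInteraction_hardCore_zero_or_top L X with h | h
    · left; rw [h, zero_mul]
    · rw [h, ENNReal.top_mul']
      split_ifs <;> simp
  rw [lintegral_eq_zero_of_zero_or_top hmeas h01 (ENNReal.add_ne_top.1 hfin).2, add_zero]

/-- **Exact occupation sum rule for the hard core** (Parseval, tree:
`tsum_fracDispersion_two_mul_cellOccupation`): for every finite-energy periodic hard-core state,
`∑_p |2πp/L|² n_p(Ψ) = ⟨Ψ, HΨ⟩` — the WHOLE energy is visible in the occupations, an identity the
integrable half of the crux lacks (there `∑_p |2πp/L|² n_p = T < E`). [folklore] -/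
theorem hardCore_occupation_sumRule (hL : 0 < L) (Ψ : PeriodicTrialState N L)
    (hfin : periodicEnergy hardCore Ψ ≠ ⊤) :
    ∑' p : Fin 3 → ℤ, fracDispersion 2 L p * cellOccupation N L (planeWaveMode L p) Ψ.ψ =
      periodicEnergy hardCore Ψ :=
  (tsum_fracDispersion_two_mul_cellOccupation hL Ψ).trans (periodicEnergy_hardCore_eq_kinetic Ψ hfin).symm

/-- **Two-sided kinetic sum rule for hard-core near-minimisers.** On the torus `L_N`, every
finite-energy `δ`-near-minimiser of the hard-core gas has its occupations pinned on the shell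
`E₀ ≤ ∑_p |2πp/L_N|² n_p ≤ E₀ + δ`, `E₀ = E₀^{per}(hardCore, N, L_N)` (`≈ 4πaρN`, Lieb–Yngvason, for
`ρ < ρ₀`). In Bogoliubov's picture this budget sits at `|p| ∼ 1/a`, far above the window
`|p| ≲ κ√ρ`; the crux for hard cores asserts that no more than `C√ρL_N/‖k‖` per mode of it leaks into
the window. A prover of the non-integrable half may use this exact f-sum-type identity in place of the
unavailable `‖v‖₁`/`v̂` double commutators. [folklore] -/
theorem hardCore_nearMin_sumRule {ρ : ℝ} (hρ : 0 < ρ) {N : ℕ} (hN : 0 < N) {δ : ℝ≥0∞}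
    (Ψ : PeriodicTrialState N (sideLength ρ N)) (hΨ : NearMin hardCore ρ N δ Ψ)
    (hfin : periodicEnergy hardCore Ψ ≠ ⊤) :
    periodicGroundStateEnergy hardCore N (sideLength ρ N) ≤
        ∑' p : Fin 3 → ℤ, fracDispersion 2 (sideLength ρ N) p *
          cellOccupation N (sideLength ρ N) (planeWaveMode (sideLength ρ N) p) Ψ.ψ ∧
      ∑' p : Fin 3 → ℤ, fracDispersion 2 (sideLength ρ N) p *
          cellOccupation N (sideLength ρ N) (planeWaveMode (sideLength ρ N) p) Ψ.ψ ≤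
        periodicGroundStateEnergy hardCore N (sideLength ρ N) + δ := by
  rw [hardCore_occupation_sumRule (sideLength_pos_of_pos hρ hN) Ψ hfin]
  exact ⟨periodicGroundStateEnergy_le hardCore Ψ, hΨ⟩

end Summit.AtomisticToContinuum.BoseEinsteinCondensation.Theorems.PeriodicIRBound.Negative

end
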